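import Summits.Ventures.LatticeQCDFlow.Scaling.LumpedStarCollectorFloor
import Summits.Ventures.LatticeQCDFlow.Scaling.HomStarCrowdedMass

/-!
HONEST FRAMING: exact (Metropolis-corrected) sampling algorithms for lattice gauge theory; figures
of merit are autocorrelation/cost numbers at stated couplings and volumes; no continuum-physics
claim.

# HomStarCollectorFloor — THE `log K` FLOOR AT THE SCHEME LEVEL: FOR CHAPTER U's HOMOGENEOUS REPLICA-EXCHANGE STAR, FROM THE CONFIGURATION WITH EVERY LEVEL AT `u`, THE LAW OF
# (HUB CONTENT, COMPOSITION) AFTER `n` SCHEME STEPS IS AT DISTANCE `≥ 1 − s/(s−m)² − (μ_0(u) + Kμ_1(u))/m` FROM `π_S`, `s = K(1−ta/K)ⁿ`; HENCE AT DISTANCE `≥ 1/3` FOR EVERY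
# `n ≤ (K/(ta) − 1)·log(K/(3(μ_0(u) + Kμ_1(u) + 2)))` — THE COUPON COLLECTOR OVER THE `K` COLD REPLICAS IN SCHEME STEPS (lean-2 GEN-45, ours)

Venture-side (OURS).  Cell `lqcd-flow` (pub-lqcd), unit `pub-lqcd-lean-2-g45`, 2026-08-31.  Chapter AE, file 3 — file 2 at the scheme level, as chapter AD file 11 did for file 6.  By AD8 the
scheme `t·ptGraphSwap + (1−t)·prodKernel` lumps through `Λ = (hub content, composition)` onto `S_l = t·A + (1−t)w_0·B + (1−t)(1−w_0)·I`; the cold `u`-count `G = N(u) − 𝟙{hub = u}` drops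
by at most one under `S_l` and is lowered with probability `≤ t·(a/K)·G` (file 2's pieces: the redraw and the idle part vanish on `{G' + 1 = G}`, the swap part is `(N(u)/K)·acc(hub,u)`
from a hub `≠ u`), so file 1 applies with `θ = ta/K`; AD9's push-forward identity carries the floor to the scheme started at `y_u ≡ u` (`Λy_u` = the crowded state, `G = K`), and AD15's
identification `π_S = Λ_*(μ_0⊗μ_1⊗⋯⊗μ_1)` computes `E_{π_S}N(u) = μ_0(u) + Kμ_1(u)`.

* `homStar_lazy_coldCount_drop`, `homStar_lazy_coldCount_down` (`θ = ta/K` for `S_l`), `homStar_piS_expect_count` (`E_{π_S}N(u) = μ_0(u) + Kμ_1(u)`),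
  **`homStar_pooled_tvDist_ge_collector`** (`‖Λ_*(δ_{y_u}Pⁿ) − π‖_TV ≥ 1 − s/(s−m)² − π{N(u) ≥ m}`, any unit-mass `π ≥ 0`, `s = K(1−ta/K)ⁿ`, `m < s`),
  **`homStar_pooled_tvDist_ge_collector_law`** (`≥ 1 − s/(s−m)² − (μ_0(u) + Kμ_1(u))/m` against `π_S`, `0 < m < s`),
  **`homStar_pooled_tvDist_ge_third`** (**for `n ≤ (K/(ta) − 1)·log(K/(3(μ_0(u) + Kμ_1(u) + 2)))` the pooled law is at distance `≥ 1/3` from `π_S`**).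

Reading (no numerics implied): with chapter AD file 12 (`ε`-close after `O((K/(p̄·min{t,h}))·log(K³/(tp̄ε)))` scheme steps) and file 11 ∕ 16 (`Ω(K·max{1/h, 1/(ta)})`), the pooled
observables of the homogeneous replica-exchange star obey `t^{pooled}_mix ≥ (K/(ta) − 1)·log(K/(3(μ_0(u)+Kμ_1(u)+2)))`: each cold replica must be reached by an ACCEPTED swap (rate
`≤ ta/K` per replica and step), so a content `u` that is rare under the equilibrium (`μ_0(u) + Kμ_1(u) = O(1)`) cannot be diluted to its equilibrium frequency before the coupon-collector
time `(K/(ta))·log K` — the logarithm on the floor side, law-dependent through `E_{π_S}N(u)` only (for `μ_1(u)` of order one the bound carries no logarithm; NOT CLAIMED there).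
Literature grade (cell rule): OWN, elementary on files 1–2 and chapter AD; nothing cited as a fact; no new bib keys.
-/

noncomputable section

open Finset Function
open Literature.Probability.MarkovChains

namespace Summit.Ventures.LatticeQCDFlow.Scaling

section SchemeCollector
variable {S : Type*} [Fintype S] [DecidableEq S] {K m : ℕ} {μ : Fin (K + 1) → S → ℝ} {M : Fin (K + 1) → S → S → ℝ} {w : Fin (K + 1) → ℝ} {t : ℝ}
variable (κ : Fin m → Fin K)
variable {X : Type*} [Fintype X] [DecidableEq X] {hub : X → S} {comp : X → S → ℕ} {W : S → ℝ} {acc : S → S → ℝ} {Kh : (S → ℕ) → S → S → ℝ}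
variable {Ast Bst Sl : X → X → ℝ} {g : (S → ℕ) → ℝ} {πS : X → ℝ} {Z : ℝ}
variable {Λ : (Fin (K + 1) → S) → X}

/-! ## §1 The lazy lumped kernel wears the cold `u`-count down at rate `≤ ta/K` -/

omit κ [Fintype X] in
/-- **`G` drops by at most one per step of `S_l`:** a swap keeps the composition, a redraw keeps `G`, an idle step keeps the state. [ours] -/
theorem homStar_lazy_coldCount_drop (hhub : ∀ x, comp x (hub x) ≠ 0)
    (hA : ∀ x x', Ast x x' = if comp x' = comp x then Kh (comp x) (hub x) (hub x') else 0)
    (hB : ∀ x x', Bst x x' = μ 0 (hub x') * (if comp x' + Pi.single (hub x) 1 = comp x + Pi.single (hub x') 1 then 1 else 0))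
    (hSl : ∀ x x', Sl x x' = t * Ast x x' + (1 - t) * (w 0 * Bst x x' + (1 - w 0) * (if x = x' then 1 else 0))) (u : S) (x y : X) (hxy : Sl x y ≠ 0) :
    comp x u - (if hub x = u then 1 else 0) ≤ comp y u - (if hub y = u then 1 else 0) + 1 := by
  by_cases hc : comp y = comp x
  · rw [hc]
    have hy1 : hub y = u → 1 ≤ comp x u := fun e => by rw [← hc, ← e]; exact Nat.one_le_iff_ne_zero.mpr (hhub y)
    by_cases hx : hub x = u <;> by_cases hy : hub y = u
    · rw [if_pos hx, if_pos hy]; omega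
    · rw [if_pos hx, if_neg hy]; omega
    · rw [if_neg hx, if_pos hy]; have := hy1 hy; omega
    · rw [if_neg hx, if_neg hy]; omega
  · by_cases hr : comp y + Pi.single (hub x) 1 = comp x + Pi.single (hub y) 1
    · rw [coldCount_redraw hhub u hr]; omega
    · have hne : x ≠ y := fun e => hc (by rw [e])
      exfalso; apply hxy
      rw [hSl, hA, if_neg hc, hB, if_neg hr, if_neg hne]; ring

omit κ in
/-- **THE DOWN-PROBABILITY OF `S_l`:** `Σ_{y : G y + 1 = G x} S_l(x,y) ≤ (ta/K)·G(x)` (`t ≥ 0`, `A ≥ 0`, `acc(·,u) ≤ a` off `u`) — on that event only the swap part survives. [ours] -/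
theorem homStar_lazy_coldCount_down (hinj : ∀ x x', hub x = hub x' → comp x = comp x' → x = x')
    (hsurj : ∀ (z : S) (N : S → ℕ), ∑ v, N v = K + 1 → N z ≠ 0 → ∃ x, hub x = z ∧ comp x = N) (hhub : ∀ x, comp x (hub x) ≠ 0)
    (hsum : ∀ x, ∑ v, comp x v = K + 1)
    (hKoff : ∀ N h v, h ≠ v → Kh N h v = if N h = 0 then 0 else (N v : ℝ) / K * acc h v) (ht0 : 0 ≤ t)
    (hA : ∀ x x', Ast x x' = if comp x' = comp x then Kh (comp x) (hub x) (hub x') else 0) (hA0 : ∀ x x', 0 ≤ Ast x x')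
    (hB : ∀ x x', Bst x x' = μ 0 (hub x') * (if comp x' + Pi.single (hub x) 1 = comp x + Pi.single (hub x') 1 then 1 else 0))
    (hSl : ∀ x x', Sl x x' = t * Ast x x' + (1 - t) * (w 0 * Bst x x' + (1 - w 0) * (if x = x' then 1 else 0)))
    (u : S) {a : ℝ} (ha0 : 0 ≤ a) (ha : ∀ h, h ≠ u → acc h u ≤ a) (x : X) :
    ∑ y ∈ univ.filter (fun y => comp y u - (if hub y = u then 1 else 0) + 1 = comp x u - (if hub x = u then 1 else 0)), Sl x y
      ≤ t * a / K * ((comp x u - (if hub x = u then 1 else 0) : ℕ) : ℝ) := by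
  classical
  rw [Finset.sum_filter]
  have key : ∀ y, (if comp y u - (if hub y = u then 1 else 0) + 1 = comp x u - (if hub x = u then 1 else 0) then Sl x y else 0)
      ≤ t * ((if hub x = u then (0 : ℝ) else 1) * (Ast x y * (if hub y = u then (1 : ℝ) else 0))) := by
    intro y
    have hsw := coldCount_swap_filter hhub hA hA0 u x y
    by_cases hf : comp y u - (if hub y = u then 1 else 0) + 1 = comp x u - (if hub x = u then 1 else 0)
    · rw [if_pos hf] at hsw ⊢
      have hne : x ≠ y := fun e => by rw [e] at hf; omega
      rw [hSl, coldCount_redraw_filter hhub hB u x y hf, if_neg hne]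
      have : t * Ast x y ≤ t * ((if hub x = u then (0 : ℝ) else 1) * (Ast x y * (if hub y = u then (1 : ℝ) else 0))) := mul_le_mul_of_nonneg_left hsw ht0
      linarith
    · rw [if_neg hf] at hsw ⊢
      exact mul_nonneg ht0 hsw
  refine (sum_le_sum fun y _ => key y).trans ?_
  rw [← mul_sum]
  have h := coldCount_swap_down hinj hsurj hhub hsum hKoff hA u ha0 ha x
  have e : t * a / K * (((comp x u - (if hub x = u then 1 else 0)) : ℕ) : ℝ) = t * (a / K * (((comp x u - (if hub x = u then 1 else 0)) : ℕ) : ℝ)) := by ring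
  rw [e]; exact mul_le_mul_of_nonneg_left h ht0

/-! ## §2 `E_{π_S}N(u) = μ_0(u) + K·μ_1(u)` -/

/-- **The stationary mean of the `u`-count:** `Σ_x π_S(x)·N(u)(x) = μ_0(u) + K·μ_1(u)` (AD15's `π_S = Λ_*(μ_0⊗μ_1⊗⋯⊗μ_1)` and the product-law count). [ours] -/
theorem homStar_piS_expect_count [Nonempty X] (hm : 1 ≤ m) (hμ : ∀ k x, 0 < μ k x) (hμsum : ∀ k, ∑ u, μ k u = 1)
    (hhom : ∀ i : Fin K, μ i.succ = μ 1) (hw0 : ∀ k, 0 ≤ w k) (hw00 : 0 < w 0) (hw1 : ∑ k, w k = 1) (ht0 : 0 < t) (ht1 : t < 1)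
    (hM0 : ∀ u v, M 0 u v = μ 0 v) (hidle : ∀ i : Fin K, ∀ u v, M i.succ u v = if v = u then 1 else 0)
    {c : ℕ} (hunif : ∀ i : Fin K, (univ.filter fun r : Fin m => κ r = i).card = c)
    (hWdef : ∀ v, W v = μ 1 v / μ 0 v) (hinj : ∀ x x', hub x = hub x' → comp x = comp x' → x = x') (hsum : ∀ x, ∑ v, comp x v = K + 1)
    (hsurj : ∀ (z : S) (N : S → ℕ), ∑ v, N v = K + 1 → N z ≠ 0 → ∃ x, hub x = z ∧ comp x = N) (hhub : ∀ x, comp x (hub x) ≠ 0) (hK : 1 ≤ K)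
    (hacc : ∀ h v, acc h v = min 1 (W h / W v))
    (hKoff : ∀ N h v, h ≠ v → Kh N h v = if N h = 0 then 0 else (N v : ℝ) / K * acc h v) (hKdiag : ∀ N h, Kh N h h = 1 - ∑ v ∈ univ.erase h, Kh N h v)
    (hA : ∀ x x', Ast x x' = if comp x' = comp x then Kh (comp x) (hub x) (hub x') else 0)
    (hB : ∀ x x', Bst x x' = μ 0 (hub x') * (if comp x' + Pi.single (hub x) 1 = comp x + Pi.single (hub x') 1 then 1 else 0))
    (hSl : ∀ x x', Sl x x' = t * Ast x x' + (1 - t) * (w 0 * Bst x x' + (1 - w 0) * (if x = x' then 1 else 0)))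
    (hg : ∀ N, g N = ∏ v, (μ 0 v * W v) ^ (N v) / ((N v).factorial : ℝ))
    (hZ : Z = ∑ x, g (comp x) * ((comp x (hub x) : ℝ) / W (hub x))) (hπS : ∀ x, πS x = g (comp x) * ((comp x (hub x) : ℝ) / W (hub x)) / Z)
    (hΛh : ∀ y, hub (Λ y) = y 0) (hΛc : ∀ y v, comp (Λ y) v = (univ.filter fun k : Fin (K + 1) => y k = v).card) (u : S) :
    ∑ x, πS x * (comp x u : ℝ) = μ 0 u + K * μ 1 u := by
  classical
  have hπ : ∀ x, πS x = ∑ y ∈ univ.filter (fun y => Λ y = x), tensorFun μ y := fun x =>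
    homStar_piS_eq_pushforward κ hm hμ hμsum hhom hw0 hw00 hw1 ht0 ht1 hM0 hidle hunif hWdef hinj hsum hsurj hhub hK hacc hKoff hKdiag hA hB hSl hg hZ hπS hΛh hΛc x
  rw [sum_congr rfl fun x _ => by rw [hπ x], ← pushforward_sum_mul (tensorFun μ) (fun x => (comp x u : ℝ))]
  rw [sum_congr rfl fun y _ => by rw [hΛc y u], tensorFun_expect_count hμsum u, Fin.sum_univ_succ]
  congr 1
  rw [sum_congr rfl fun (i : Fin K) _ => show μ i.succ u = μ 1 u by rw [hhom i], sum_const, card_univ, Fintype.card_fin]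
  simp

/-! ## §3 The floors at the scheme level -/

/-- **THE COUPON-COLLECTOR FLOOR AT THE SCHEME LEVEL** (see the module docstring): from the configuration `y_u ≡ u`, for every unit-mass `π ≥ 0`, every `n` and every `m < s`,
`s = K(1−ta/K)ⁿ` (`0 ≤ t ≤ 1`, `0 ≤ a ≤ 1`, `acc(·,u) ≤ a` off `u`, `K ≥ 2`): **`‖Λ_*(δ_{y_u}Pⁿ) − π‖_TV ≥ 1 − s/(s−m)² − π{x : m ≤ N(u)}`**. [ours] -/
theorem homStar_pooled_tvDist_ge_collector (hm : 1 ≤ m) (hμ : ∀ k x, 0 < μ k x) (hμsum : ∀ k, ∑ u, μ k u = 1) (hhom : ∀ i : Fin K, μ i.succ = μ 1)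
    (hw0 : ∀ k, 0 ≤ w k) (hw1 : ∑ k, w k = 1) (ht0 : 0 ≤ t) (ht1 : t ≤ 1)
    (hM0 : ∀ u v, M 0 u v = μ 0 v) (hidle : ∀ i : Fin K, ∀ u v, M i.succ u v = if v = u then 1 else 0)
    {c : ℕ} (hunif : ∀ i : Fin K, (univ.filter fun r : Fin m => κ r = i).card = c)
    (hinj : ∀ x x', hub x = hub x' → comp x = comp x' → x = x')
    (hsurj : ∀ (z : S) (N : S → ℕ), ∑ v, N v = K + 1 → N z ≠ 0 → ∃ x, hub x = z ∧ comp x = N) (hhub : ∀ x, comp x (hub x) ≠ 0)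
    (hsum : ∀ x, ∑ v, comp x v = K + 1) (hK : 2 ≤ K)
    (hacc : ∀ u v, acc u v = min 1 (μ 0 v * μ 1 u / (μ 0 u * μ 1 v)))
    (hKoff : ∀ N h v, h ≠ v → Kh N h v = if N h = 0 then 0 else (N v : ℝ) / K * acc h v) (hKdiag : ∀ N h, Kh N h h = 1 - ∑ v ∈ univ.erase h, Kh N h v)
    (hA : ∀ x x', Ast x x' = if comp x' = comp x then Kh (comp x) (hub x) (hub x') else 0)
    (hB : ∀ x x', Bst x x' = μ 0 (hub x') * (if comp x' + Pi.single (hub x) 1 = comp x + Pi.single (hub x') 1 then 1 else 0))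
    (hΛh : ∀ y, hub (Λ y) = y 0) (hΛc : ∀ y v, comp (Λ y) v = (univ.filter fun k : Fin (K + 1) => y k = v).card)
    (u : S) {a : ℝ} (ha0 : 0 ≤ a) (ha1 : a ≤ 1) (ha : ∀ h, h ≠ u → acc h u ≤ a) {π : X → ℝ} (hπ0 : ∀ x, 0 ≤ π x) (hπ1 : ∑ x, π x = 1) (n : ℕ)
    {mm : ℝ} (hms : mm < (K : ℝ) * (1 - t * a / K) ^ n) :
    1 - (K : ℝ) * (1 - t * a / K) ^ n / ((K : ℝ) * (1 - t * a / K) ^ n - mm) ^ 2 - ∑ x ∈ univ.filter (fun x => mm ≤ (comp x u : ℝ)), π x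
      ≤ tvDist (fun x' => ∑ z ∈ univ.filter (fun z => Λ z = x'),
          lawAt (fun y z => t * ptGraphSwap μ (fun r : Fin m => (((0 : Fin (K + 1)), (κ r).succ) : Fin (K + 1) × Fin (K + 1))) (fun _ : Fin m => Equiv.refl S) y z
            + (1 - t) * prodKernel w M y z) (Pi.single (fun _ : Fin (K + 1) => u) 1) n z) π := by
  classical
  -- the lazy lumped kernel and the push-forward identity (AD8 ∕ AD9)
  obtain ⟨Sl, hSl⟩ : ∃ Sl : X → X → ℝ, ∀ x x', Sl x x' = t * Ast x x' + (1 - t) * (w 0 * Bst x x' + (1 - w 0) * (if x = x' then 1 else 0)) :=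
    ⟨_, fun _ _ => rfl⟩
  rw [homStar_pushforward_lawAt κ hm hμ hhom hw1 hM0 hidle hunif hacc hKoff hKdiag hA hB hSl hΛh hΛc hinj (Pi.single (fun _ : Fin (K + 1) => u) 1) n]
  have hδ : (fun x => ∑ y' ∈ univ.filter (fun y' => Λ y' = x), (Pi.single (fun _ : Fin (K + 1) => u) (1 : ℝ) : (Fin (K + 1) → S) → ℝ) y') = Pi.single (Λ (fun _ => u)) 1 :=
    funext fun x => lumping_pushforward_single (fun _ => u) x
  rw [hδ]
  -- X5's objects
  have hW : ∀ v, 0 < μ 1 v / μ 0 v := fun v => div_pos (hμ 1 v) (hμ 0 v)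
  have hacc' : ∀ h v, acc h v = min 1 ((μ 1 h / μ 0 h) / (μ 1 v / μ 0 v)) := by
    intro h v; rw [hacc]; congr 1
    have h1 := hμ 0 h; have h2 := hμ 0 v; have h3 := hμ 1 h; have h4 := hμ 1 v
    field_simp
  have hK1 : 1 ≤ K := by omega
  have hμ00 : ∀ v, 0 ≤ μ 0 v := fun v => (hμ 0 v).le
  have hA0 : ∀ x x', 0 ≤ Ast x x' := starStep_swap_nonneg hW hacc' hK1 hsum hKoff hKdiag hA
  have hA1 : ∀ x, ∑ x', Ast x x' = 1 := starStep_swap_rowsum hinj hsurj hhub hsum hKoff hKdiag hA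
  have hB0 : ∀ x x', 0 ≤ Bst x x' := fun x x' => by rw [hB]; exact mul_nonneg (hμ00 _) (by split_ifs <;> norm_num)
  have hB1 : ∀ x, ∑ x', Bst x x' = 1 := starStep_redraw_rowsum hinj hsurj hhub hsum (hμsum 0) hB
  have hw01 : w 0 ≤ 1 := by
    calc w 0 ≤ ∑ k, w k := single_le_sum (fun k _ => hw0 k) (mem_univ 0)
      _ = 1 := hw1
  have hSlrs : IsRowStochastic Sl := by
    refine ⟨fun x x' => ?_, fun x => ?_⟩
    · rw [hSl]
      exact add_nonneg (mul_nonneg ht0 (hA0 x x'))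
        (mul_nonneg (by linarith) (add_nonneg (mul_nonneg (hw0 0) (hB0 x x')) (mul_nonneg (by linarith) (by split_ifs <;> norm_num))))
    · simp_rw [hSl]
      rw [sum_add_distrib, ← mul_sum, hA1, ← mul_sum, sum_add_distrib, ← mul_sum, hB1, ← mul_sum]
      rw [Finset.sum_ite_eq univ x, if_pos (mem_univ _)]; ring
  -- file 1's hypotheses for `S_l` with `θ = ta/K`
  obtain ⟨Q, hQ⟩ : ∃ Q : (ℕ → ℝ) → ℕ → ℝ, ∀ f j, Q f j = t * a / K * j * f (j - 1) + (1 - t * a / K * j) * f j := ⟨fun f j => _, fun _ _ => rfl⟩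
  have hKpos : (0 : ℝ) < K := by exact_mod_cast (by omega : 0 < K)
  have hθ0 : 0 ≤ t * a / K := div_nonneg (mul_nonneg ht0 ha0) hKpos.le
  have hta1 : t * a ≤ 1 := by nlinarith
  have hθK : t * a / K * K ≤ 1 := by rw [div_mul_cancel₀ _ hKpos.ne']; exact hta1
  have hθh : 2 * (t * a / K) ≤ 1 := by
    rw [show 2 * (t * a / K) = 2 * (t * a) / K by ring, div_le_one hKpos]
    have : (2 : ℝ) ≤ K := by exact_mod_cast hK
    nlinarith
  have hGK : ∀ x, comp x u - (if hub x = u then 1 else 0) ≤ K := coldCount_le hhub hsum u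
  have hdrop := homStar_lazy_coldCount_drop hhub hA hB hSl u
  have hdown := homStar_lazy_coldCount_down hinj hsurj hhub hsum hKoff ht0 hA hA0 hB hSl u ha0 ha
  have hg : ∀ x, (((comp x u - (if hub x = u then 1 else 0)) : ℕ) : ℝ) ≤ (comp x u : ℝ) := fun x => by exact_mod_cast Nat.sub_le _ _
  -- the crowded state `Λ(u,…,u)`, `G = K`
  set x₀ := Λ (fun _ : Fin (K + 1) => u) with hx₀
  have hx₀c : comp x₀ u = K + 1 := by rw [hx₀, hΛc]; simp
  have hx₀h : hub x₀ = u := by rw [hx₀, hΛh]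
  have hG₀ : comp x₀ u - (if hub x₀ = u then 1 else 0) = K := by rw [hx₀c, if_pos hx₀h]; simp
  have hms' : mm < (((comp x₀ u - (if hub x₀ = u then 1 else 0)) : ℕ) : ℝ) * (1 - t * a / K) ^ n := by rw [hG₀]; exact hms
  have hmass := compare_mass_ge (G := fun x => comp x u - (if hub x = u then 1 else 0)) hQ hθ0 hθh hθK hSlrs hGK hdrop hdown x₀ n hms'
  simp only [hG₀] at hmass
  have hl1 : ∑ y, lawAt Sl (Pi.single x₀ (1 : ℝ)) n y = ∑ x, π x := by rw [sum_lawAt hSlrs, Finset.sum_pi_single', if_pos (mem_univ _), hπ1]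
  have htv := sub_sum_le_tvDist hl1 (univ.filter (fun y => mm ≤ (((comp y u - (if hub y = u then 1 else 0)) : ℕ) : ℝ)))
  have hmono : ∑ x ∈ univ.filter (fun x => mm ≤ (((comp x u - (if hub x = u then 1 else 0)) : ℕ) : ℝ)), π x ≤ ∑ x ∈ univ.filter (fun x => mm ≤ (comp x u : ℝ)), π x :=
    sum_le_sum_of_subset_of_nonneg (fun x hx => by
      rw [mem_filter] at hx ⊢; exact ⟨hx.1, le_trans hx.2 (hg x)⟩) fun x _ _ => hπ0 x
  linarith

/-- **THE SAME AGAINST `π_S`, WITH ITS `u`-COUNT MASS BY MARKOV:** `‖Λ_*(δ_{y_u}Pⁿ) − π_S‖_TV ≥ 1 − s/(s−m)² − (μ_0(u) + Kμ_1(u))/m` for every `0 < m < s = K(1−ta/K)ⁿ`. [ours] -/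
theorem homStar_pooled_tvDist_ge_collector_law [Nonempty X] (hm : 1 ≤ m) (hμ : ∀ k x, 0 < μ k x) (hμsum : ∀ k, ∑ u, μ k u = 1)
    (hhom : ∀ i : Fin K, μ i.succ = μ 1) (hw0 : ∀ k, 0 ≤ w k) (hw00 : 0 < w 0) (hw1 : ∑ k, w k = 1) (ht0 : 0 < t) (ht1 : t < 1)
    (hM0 : ∀ u v, M 0 u v = μ 0 v) (hidle : ∀ i : Fin K, ∀ u v, M i.succ u v = if v = u then 1 else 0)
    {c : ℕ} (hunif : ∀ i : Fin K, (univ.filter fun r : Fin m => κ r = i).card = c)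
    (hWdef : ∀ v, W v = μ 1 v / μ 0 v) (hinj : ∀ x x', hub x = hub x' → comp x = comp x' → x = x') (hsum : ∀ x, ∑ v, comp x v = K + 1)
    (hsurj : ∀ (z : S) (N : S → ℕ), ∑ v, N v = K + 1 → N z ≠ 0 → ∃ x, hub x = z ∧ comp x = N) (hhub : ∀ x, comp x (hub x) ≠ 0) (hK : 2 ≤ K)
    (hacc : ∀ h v, acc h v = min 1 (W h / W v))
    (hKoff : ∀ N h v, h ≠ v → Kh N h v = if N h = 0 then 0 else (N v : ℝ) / K * acc h v) (hKdiag : ∀ N h, Kh N h h = 1 - ∑ v ∈ univ.erase h, Kh N h v)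
    (hA : ∀ x x', Ast x x' = if comp x' = comp x then Kh (comp x) (hub x) (hub x') else 0)
    (hB : ∀ x x', Bst x x' = μ 0 (hub x') * (if comp x' + Pi.single (hub x) 1 = comp x + Pi.single (hub x') 1 then 1 else 0))
    (hSl : ∀ x x', Sl x x' = t * Ast x x' + (1 - t) * (w 0 * Bst x x' + (1 - w 0) * (if x = x' then 1 else 0)))
    (hg : ∀ N, g N = ∏ v, (μ 0 v * W v) ^ (N v) / ((N v).factorial : ℝ))
    (hZ : Z = ∑ x, g (comp x) * ((comp x (hub x) : ℝ) / W (hub x))) (hπS : ∀ x, πS x = g (comp x) * ((comp x (hub x) : ℝ) / W (hub x)) / Z)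
    (hΛh : ∀ y, hub (Λ y) = y 0) (hΛc : ∀ y v, comp (Λ y) v = (univ.filter fun k : Fin (K + 1) => y k = v).card)
    (u : S) {a : ℝ} (ha0 : 0 ≤ a) (ha1 : a ≤ 1) (ha : ∀ h, h ≠ u → acc h u ≤ a) (n : ℕ) {mm : ℝ} (hmm : 0 < mm)
    (hms : mm < (K : ℝ) * (1 - t * a / K) ^ n) :
    1 - (K : ℝ) * (1 - t * a / K) ^ n / ((K : ℝ) * (1 - t * a / K) ^ n - mm) ^ 2 - (μ 0 u + K * μ 1 u) / mm
      ≤ tvDist (fun x' => ∑ z ∈ univ.filter (fun z => Λ z = x'),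
          lawAt (fun y z => t * ptGraphSwap μ (fun r : Fin m => (((0 : Fin (K + 1)), (κ r).succ) : Fin (K + 1) × Fin (K + 1))) (fun _ : Fin m => Equiv.refl S) y z
            + (1 - t) * prodKernel w M y z) (Pi.single (fun _ : Fin (K + 1) => u) 1) n z) πS := by
  classical
  have hK1 : 1 ≤ K := by omega
  have hW : ∀ v, 0 < W v := fun v => by rw [hWdef]; exact div_pos (hμ 1 v) (hμ 0 v)
  have hacc' : ∀ u v, acc u v = min 1 (μ 0 v * μ 1 u / (μ 0 u * μ 1 v)) := by
    intro u v
    rw [hacc, hWdef, hWdef]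
    congr 1
    have h1 := hμ 0 u; have h2 := hμ 0 v; have h3 := hμ 1 u; have h4 := hμ 1 v
    field_simp
  have hπ := lumpedStar_piS_pos hhub hW (hμ 0) hg hZ hπS
  have hπ1 := lumpedStar_piS_sum hhub hW (hμ 0) hg hZ hπS
  have h1 := homStar_pooled_tvDist_ge_collector κ hm hμ hμsum hhom hw0 hw1 ht0.le ht1.le hM0 hidle hunif hinj hsurj hhub hsum hK hacc' hKoff hKdiag hA hB hΛh hΛc
    u ha0 ha1 ha (fun x => (hπ x).le) hπ1 n hms
  -- Markov under `π_S`
  have he := homStar_piS_expect_count κ hm hμ hμsum hhom hw0 hw00 hw1 ht0 ht1 hM0 hidle hunif hWdef hinj hsum hsurj hhub hK1 hacc hKoff hKdiag hA hB hSl hg hZ hπS hΛh hΛc u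
  have hMarkov : ∑ x ∈ univ.filter (fun x => mm ≤ (comp x u : ℝ)), πS x ≤ (μ 0 u + K * μ 1 u) / mm := by
    rw [le_div_iff₀ hmm, ← he]
    have h2 : (∑ x ∈ univ.filter (fun x => mm ≤ (comp x u : ℝ)), πS x) * mm ≤ ∑ x ∈ univ.filter (fun x => mm ≤ (comp x u : ℝ)), πS x * (comp x u : ℝ) := by
      rw [sum_mul]; exact sum_le_sum fun x hx => mul_le_mul_of_nonneg_left (mem_filter.mp hx).2 (hπ x).le
    have h3 : ∑ x ∈ univ.filter (fun x => mm ≤ (comp x u : ℝ)), πS x * (comp x u : ℝ) ≤ ∑ x, πS x * (comp x u : ℝ) :=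
      sum_le_sum_of_subset_of_nonneg (filter_subset _ _) fun x _ _ => mul_nonneg (hπ x).le (Nat.cast_nonneg _)
    linarith
  linarith

/-- **THE `log K` FLOOR IN SCHEME STEPS:** for every `n ≤ (K/(ta) − 1)·log(K/(3(μ_0(u) + Kμ_1(u) + 2)))` (`0 < t < 1`, `0 < a ≤ 1`, `acc(·,u) ≤ a` off `u`, `K ≥ 2`), the law of
(hub content, composition) after `n` scheme steps from `y_u ≡ u` is at total-variation distance **`≥ 1/3`** from `π_S`. [ours] -/
theorem homStar_pooled_tvDist_ge_third [Nonempty X] (hm : 1 ≤ m) (hμ : ∀ k x, 0 < μ k x) (hμsum : ∀ k, ∑ u, μ k u = 1)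
    (hhom : ∀ i : Fin K, μ i.succ = μ 1) (hw0 : ∀ k, 0 ≤ w k) (hw00 : 0 < w 0) (hw1 : ∑ k, w k = 1) (ht0 : 0 < t) (ht1 : t < 1)
    (hM0 : ∀ u v, M 0 u v = μ 0 v) (hidle : ∀ i : Fin K, ∀ u v, M i.succ u v = if v = u then 1 else 0)
    {c : ℕ} (hunif : ∀ i : Fin K, (univ.filter fun r : Fin m => κ r = i).card = c)
    (hWdef : ∀ v, W v = μ 1 v / μ 0 v) (hinj : ∀ x x', hub x = hub x' → comp x = comp x' → x = x') (hsum : ∀ x, ∑ v, comp x v = K + 1)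
    (hsurj : ∀ (z : S) (N : S → ℕ), ∑ v, N v = K + 1 → N z ≠ 0 → ∃ x, hub x = z ∧ comp x = N) (hhub : ∀ x, comp x (hub x) ≠ 0) (hK : 2 ≤ K)
    (hacc : ∀ h v, acc h v = min 1 (W h / W v))
    (hKoff : ∀ N h v, h ≠ v → Kh N h v = if N h = 0 then 0 else (N v : ℝ) / K * acc h v) (hKdiag : ∀ N h, Kh N h h = 1 - ∑ v ∈ univ.erase h, Kh N h v)
    (hA : ∀ x x', Ast x x' = if comp x' = comp x then Kh (comp x) (hub x) (hub x') else 0)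
    (hB : ∀ x x', Bst x x' = μ 0 (hub x') * (if comp x' + Pi.single (hub x) 1 = comp x + Pi.single (hub x') 1 then 1 else 0))
    (hSl : ∀ x x', Sl x x' = t * Ast x x' + (1 - t) * (w 0 * Bst x x' + (1 - w 0) * (if x = x' then 1 else 0)))
    (hg : ∀ N, g N = ∏ v, (μ 0 v * W v) ^ (N v) / ((N v).factorial : ℝ))
    (hZ : Z = ∑ x, g (comp x) * ((comp x (hub x) : ℝ) / W (hub x))) (hπS : ∀ x, πS x = g (comp x) * ((comp x (hub x) : ℝ) / W (hub x)) / Z)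
    (hΛh : ∀ y, hub (Λ y) = y 0) (hΛc : ∀ y v, comp (Λ y) v = (univ.filter fun k : Fin (K + 1) => y k = v).card)
    (u : S) {a : ℝ} (ha0 : 0 < a) (ha1 : a ≤ 1) (ha : ∀ h, h ≠ u → acc h u ≤ a) {n : ℕ}
    (hn : (n : ℝ) ≤ ((K : ℝ) / (t * a) - 1) * Real.log ((K : ℝ) / (3 * (μ 0 u + K * μ 1 u + 2)))) :
    1 / 3 ≤ tvDist (fun x' => ∑ z ∈ univ.filter (fun z => Λ z = x'),
          lawAt (fun y z => t * ptGraphSwap μ (fun r : Fin m => (((0 : Fin (K + 1)), (κ r).succ) : Fin (K + 1) × Fin (K + 1))) (fun _ : Fin m => Equiv.refl S) y z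
            + (1 - t) * prodKernel w M y z) (Pi.single (fun _ : Fin (K + 1) => u) 1) n z) πS := by
  set e : ℝ := μ 0 u + K * μ 1 u with hedef
  have he0 : 0 ≤ e := add_nonneg (hμ 0 u).le (mul_nonneg (Nat.cast_nonneg _) (hμ 1 u).le)
  have hKpos : (0 : ℝ) < K := by exact_mod_cast (by omega : 0 < K)
  have hta0 : 0 < t * a := mul_pos ht0 ha0
  have hta1 : t * a ≤ 1 := by nlinarith
  have hθ0 : 0 < t * a / K := div_pos hta0 hKpos
  have hθ1 : t * a / K < 1 := by
    rw [div_lt_one hKpos]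
    have : (2 : ℝ) ≤ K := by exact_mod_cast hK
    linarith
  have hC : (0 : ℝ) < 3 * (e + 2) := by linarith
  -- `n ≤ (K/(ta) − 1)·log(K/(3(e+2)))` gives `s = K(1−ta/K)ⁿ ≥ 3(e+2)`
  have hconv : (K : ℝ) / (t * a) - 1 = (1 - t * a / K) / (t * a / K) := by field_simp
  rw [hconv] at hn
  have h1 : (n : ℝ) * (t * a / K) / (1 - t * a / K) ≤ Real.log ((K : ℝ) / (3 * (e + 2))) := by
    have h1θ : 0 < 1 - t * a / K := by linarith
    have := mul_le_mul_of_nonneg_left hn (div_pos hθ0 h1θ).le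
    have e0 : t * a / K / (1 - t * a / K) * ((1 - t * a / K) / (t * a / K)) = 1 := by
      rw [div_mul_div_comm, mul_comm (t * a / K) (1 - t * a / K)]; exact div_self (mul_ne_zero h1θ.ne' hθ0.ne')
    have e1 : t * a / K / (1 - t * a / K) * ((1 - t * a / K) / (t * a / K) * Real.log ((K : ℝ) / (3 * (e + 2)))) = Real.log ((K : ℝ) / (3 * (e + 2))) := by
      rw [← mul_assoc, e0, one_mul]
    have e2 : t * a / K / (1 - t * a / K) * (n : ℝ) = n * (t * a / K) / (1 - t * a / K) := by ring
    rw [e1, e2] at this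
    exact this
  have hs : 3 * (e + 2) ≤ (K : ℝ) * (1 - t * a / K) ^ n := by
    calc 3 * (e + 2) = (K : ℝ) * Real.exp (-Real.log ((K : ℝ) / (3 * (e + 2)))) := by
          rw [Real.exp_neg, Real.exp_log (div_pos hKpos hC)]; field_simp
      _ ≤ (K : ℝ) * Real.exp (-(n * (t * a / K) / (1 - t * a / K))) := mul_le_mul_of_nonneg_left (Real.exp_le_exp.mpr (neg_le_neg h1)) hKpos.le
      _ ≤ (K : ℝ) * (1 - t * a / K) ^ n := mul_le_mul_of_nonneg_left (one_sub_pow_ge_exp hθ1 n) hKpos.le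
  set s : ℝ := (K : ℝ) * (1 - t * a / K) ^ n with hsdef
  have hs6 : 6 ≤ s := by linarith
  have hspos : 0 < s := by linarith
  have hfloor := homStar_pooled_tvDist_ge_collector_law κ hm hμ hμsum hhom hw0 hw00 hw1 ht0 ht1 hM0 hidle hunif hWdef hinj hsum hsurj hhub hK hacc hKoff hKdiag hA hB hSl hg hZ
    hπS hΛh hΛc u ha0.le ha1 ha n (mm := s / 2) (by linarith) (by linarith)
  have e1 : s / (s - s / 2) ^ 2 = 4 / s := by field_simp; ring
  have e2 : (μ 0 u + K * μ 1 u) / (s / 2) = 2 * e / s := by rw [← hedef]; field_simp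
  rw [e1, e2] at hfloor
  have hbad : 4 / s + 2 * e / s ≤ 2 / 3 := by
    rw [show 4 / s + 2 * e / s = (4 + 2 * e) / s by field_simp, div_le_iff₀ hspos]; linarith
  linarith

end SchemeCollector

end Summit.Ventures.LatticeQCDFlow.Scaling

end
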